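import Literature.Analysis.FluidPDE.TaoCascadeDuhamel
import Literature.Analysis.FluidPDE.TaoAveragedCascadeAssembly
import Literature.Analysis.FluidPDE.TaoAveragedSlotAlgebra
import HarnessLib

/-!
# Rotations and dilations on `L²(ℝ³; ℂ³)`: composition laws, invariance of the pairing, and
conjugation of complex averages by fixed per-slot rotations and dilations (Tao 2016, §3.2)

T. Tao, *Finite time blowup for an averaged three-dimensional Navier–Stokes equation*,
J. Amer. Math. Soc. **29** (2016), 601–674 = arXiv:1402.0290v3 (held as `paper:arxiv-1402.0290`),
§3.2, p. 15: "due to the presence of rotations and dilations in the definition of a complex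
average, we have the freedom to rotate and dilate each of the `ξⱼ⁰` as we please". This file
proves the operator algebra behind that sentence, over the objects of `TaoAveragedSobolev.lean`
(`rot`, `dil`, `pairing`), `TaoAveragedConjugation.lean` (`conjL2`), `TaoAveragedSlotAlgebra.lean`
(`rot_rot`, `dil_dil`, `dil_rot`) and `TaoAveragedComplexAverage.lean` (`ComplexAveragingDatum`,
`IsComplexAverageOf`):

* `conjL2_rot`, `conjL2_dil`, `conjL2_conjL2` — conjugation commutes with rotations and dilations
  (the composition laws `rot_rot`, `dil_dil`, `dil_rot` are those of `TaoAveragedSlotAlgebra.lean`);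
* `pairing_rot_rot`, `pairing_dil_dil` — the bilinear pairing `⟨u, w⟩ = ∫ u · w` is invariant
  under `Rot_R` (`R` a linear isometry) and under the `L²`-normalised `Dil_λ`, `λ > 0`;
* `ComplexAveragingDatum.precomp`, `IsComplexAverageOf.precomp` — **if `C` is a complex average
  of `C'`, then so is `(u, v, w) ↦ C(Rot_{R₁} Dil_{κ₁} u, Rot_{R₂} Dil_{κ₂} v, Rot_{R₃} Dil_{κ₃} w)`**
  for fixed rotations `Rᵢ ∈ SO(3)` and dilation factors `κᵢ > 0` (the random rotations and
  dilations of the datum are composed with the fixed ones: "rotation and dilation operators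
  normalise `𝓜₀ ⊗ ℂ`", §3.2 ¶3, here with the multipliers untouched);
* `cplxBasicCascadeForm_transport` — the complexified basic cascade form (3.6) of profiles
  `ψⱼ` equals that of the rotated–dilated profiles `ψ'ⱼ = Rot_{Rⱼ} Dil_{κⱼ} ψⱼ` evaluated at
  `(Rot_{R₁} Dil_{κ₁} u, Rot_{R₂} Dil_{κ₂} v, Rot_{R₃} Dil_{κ₃} w)` (dilations commute, the pairing
  is invariant).

These are the ingredients of the normalisation (3.7) in the proof of the §3.2 ¶2 named fact
`basicCascade_of_normalised` (`TaoAveragedCascadeSteps.lean`).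

## References

* T. Tao, J. Amer. Math. Soc. 29 (2016), 601–674, arXiv:1402.0290v3, §1.1 p. 6 ((1.11), `Rot_R`),
  §3.1 Def. 3.4, §3.2 pp. 15–16. Key `Tao2016AveragedNS`.
-/

noncomputable section

open MeasureTheory Set Filter
open scoped ENNReal NNReal SchwartzMap ComplexConjugate

namespace Literature.Analysis.FluidPDE.Tao2016

/-- Local notation for physical / frequency space `ℝ³`. -/
local notation "ℝ³" => EuclideanSpace ℝ (Fin 3)
/-- Local notation for the complexified range `ℂ³`. -/
local notation "ℂ³" => EuclideanSpace ℂ (Fin 3)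

/-! ### Conjugation, pairing: small algebra -/

/-- Conjugation of fields is an involution. [folklore] -/
theorem conjL2_conjL2 (u : L2C) : conjL2 (conjL2 u) = u := by
  apply Lp.ext
  filter_upwards [coeFn_conjL2 (conjL2 u), coeFn_conjL2 u] with x h1 h2
  rw [h1, h2, conj3_conj3]

/-- The bilinear pairing against a conjugate field is the `L²` inner product:
`⟨u, ḡ⟩ = ⟪g, u⟫`. [cite: Tao2016AveragedNS, §3.1 p. 15] -/
theorem pairing_conjL2_eq_inner (u g : L2C) : pairing u (conjL2 g) = inner ℂ g u := by
  rw [pairing_eq_inner_conjL2, conjL2_conjL2]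

/-- `|⟨u, ḡ⟩| ≤ ‖g‖ ‖u‖` (Cauchy–Schwarz). [folklore] -/
theorem norm_pairing_conjL2_le (u g : L2C) : ‖pairing u (conjL2 g)‖ ≤ ‖g‖ * ‖u‖ := by
  rw [pairing_conjL2_eq_inner]
  exact norm_inner_le_norm g u

/-- The pairing is additive in its second argument. [folklore] -/
theorem pairing_add_right (u w₁ w₂ : L2C) : pairing u (w₁ + w₂) = pairing u w₁ + pairing u w₂ := by
  rw [pairing_swap, pairing_add_left, pairing_swap w₁, pairing_swap w₂]

/-- The pairing commutes with finite sums in its second argument. [folklore] -/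
theorem pairing_sum_right {ι : Type*} (s : Finset ι) (u : L2C) (w : ι → L2C) :
    pairing u (∑ i ∈ s, w i) = ∑ i ∈ s, pairing u (w i) := by
  classical
  induction s using Finset.induction_on with
  | empty => rw [Finset.sum_empty, Finset.sum_empty, pairing_swap, pairing_zero_left]
  | insert a s ha ih => rw [Finset.sum_insert ha, Finset.sum_insert ha, pairing_add_right, ih]

/-- Conjugation commutes with finite sums. [folklore] -/
theorem conjL2_sum {ι : Type*} (s : Finset ι) (w : ι → L2C) :
    conjL2 (∑ i ∈ s, w i) = ∑ i ∈ s, conjL2 (w i) :=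
  map_sum (ContinuousLinearMap.compLpL 2 (volume : Measure ℝ³) conj3.toContinuousLinearMap) w s

/-- Rotations commute with finite sums. [folklore] -/
theorem rot_sum {ι : Type*} (R : ℝ³ ≃ₗᵢ[ℝ] ℝ³) (s : Finset ι) (u : ι → L2C) :
    rot R (∑ i ∈ s, u i) = ∑ i ∈ s, rot R (u i) := by
  classical
  induction s using Finset.induction_on with
  | empty => rw [Finset.sum_empty, Finset.sum_empty, rot_zero]
  | insert a s ha ih => rw [Finset.sum_insert ha, Finset.sum_insert ha, rot_add, ih]

/-- Dilations commute with finite sums. [folklore] -/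
theorem dil_sum {ι : Type*} (c : ℝ) (s : Finset ι) (u : ι → L2C) :
    dil c (∑ i ∈ s, u i) = ∑ i ∈ s, dil c (u i) := by
  classical
  induction s using Finset.induction_on with
  | empty => rw [Finset.sum_empty, Finset.sum_empty, dil_zero]
  | insert a s ha ih => rw [Finset.sum_insert ha, Finset.sum_insert ha, dil_add, ih]

/-- `SchwartzMap.toLp` commutes with finite sums. [folklore] -/
theorem schwartz_toLp_sum {ι : Type*} (s : Finset ι) (φ : ι → 𝓢(ℝ³, ℂ³)) :
    (∑ i ∈ s, φ i).toLp 2 (volume : Measure ℝ³) = ∑ i ∈ s, (φ i).toLp 2 (volume : Measure ℝ³) := by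
  have h := map_sum (SchwartzMap.toLpCLM ℝ ℂ³ 2 (volume : Measure ℝ³)) φ s
  simpa only [SchwartzMap.toLpCLM_apply] using h

/-! ### Conjugation commutes with `Rot_R` and `Dil_λ` -/

/-- Conjugation commutes with rotations (the matrix of `R` is real). [folklore] -/
theorem conjL2_rot (R : ℝ³ ≃ₗᵢ[ℝ] ℝ³) (u : L2C) : conjL2 (rot R u) = rot R (conjL2 u) := by
  apply Lp.ext
  filter_upwards [coeFn_conjL2 (rot R u), coeFn_rot R u, coeFn_rot R (conjL2 u),
    R.symm.measurePreserving.quasiMeasurePreserving.ae_eq (coeFn_conjL2 u)] with x h1 h2 h3 h4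
  simp only [Function.comp_apply] at h4
  rw [h1, h2, h3, h4, conj3_complexifyCLM]

/-- Conjugation commutes with dilations (the factor `c^{3/2}` is real). [folklore] -/
theorem conjL2_dil {c : ℝ} (hc : c ≠ 0) (u : L2C) : conjL2 (dil c u) = dil c (conjL2 u) := by
  apply Lp.ext
  have hq : Measure.QuasiMeasurePreserving (fun x : ℝ³ => c • x) volume volume :=
    Measure.quasiMeasurePreserving_smul volume hc
  filter_upwards [coeFn_conjL2 (dil c u), coeFn_dil hc u, coeFn_dil hc (conjL2 u),
    hq.ae_eq (coeFn_conjL2 u)] with x h1 h2 h3 h4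
  simp only [Function.comp_apply] at h4
  rw [h1, h2, h3, h4, conj3_smul, Complex.conj_ofReal]

/-! ### Invariance of the bilinear pairing -/

/-- **The pairing is rotation invariant**: `⟨Rot_R u, Rot_R w⟩ = ⟨u, w⟩` (`R ⊗ 1` preserves the
bilinear dot product, `R⁻¹` preserves Lebesgue measure). [cite: Tao2016AveragedNS, §1.1 p. 6] -/
theorem pairing_rot_rot (R : ℝ³ ≃ₗᵢ[ℝ] ℝ³) (u w : L2C) :
    pairing (rot R u) (rot R w) = pairing u w := by
  unfold pairing
  calc ∫ x, cdot ((rot R u : ℝ³ → ℂ³) x) ((rot R w : ℝ³ → ℂ³) x)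
      = ∫ x, cdot ((u : ℝ³ → ℂ³) (R.symm x)) ((w : ℝ³ → ℂ³) (R.symm x)) := by
        refine integral_congr_ae ?_
        filter_upwards [coeFn_rot R u, coeFn_rot R w] with x h1 h2
        rw [h1, h2]
        exact cdot_complexifyCLM R _ _
    _ = ∫ y, cdot ((u : ℝ³ → ℂ³) y) ((w : ℝ³ → ℂ³) y) :=
        R.symm.measurePreserving.integral_comp R.symm.toHomeomorph.measurableEmbedding
          (fun y => cdot ((u : ℝ³ → ℂ³) y) ((w : ℝ³ → ℂ³) y))

/-- `c^{3/2} · c^{3/2} = c³` for `c > 0`. [folklore] -/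
theorem rpow_three_halves_mul_self {c : ℝ} (hc : 0 < c) :
    c ^ (3 / 2 : ℝ) * c ^ (3 / 2 : ℝ) = c ^ 3 := by
  rw [← Real.rpow_add hc, ← Real.rpow_natCast]
  norm_num

/-- **The pairing is dilation invariant**: `⟨Dil_c u, Dil_c w⟩ = ⟨u, w⟩` for `c > 0` (the
exponent `3/2` in (1.11) makes `Dil_c` unitary: `c³ · |c³|⁻¹ = 1`). [cite: Tao2016AveragedNS, (1.11)] -/
theorem pairing_dil_dil {c : ℝ} (hc : 0 < c) (u w : L2C) :
    pairing (dil c u) (dil c w) = pairing u w := by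
  unfold pairing
  set F : ℝ³ → ℂ := fun y => cdot ((u : ℝ³ → ℂ³) y) ((w : ℝ³ → ℂ³) y) with hF
  have hs : (((c ^ (3 / 2 : ℝ) : ℝ)) : ℂ) * (((c ^ (3 / 2 : ℝ) : ℝ)) : ℂ) = ((c ^ 3 : ℝ) : ℂ) := by
    rw [← Complex.ofReal_mul, rpow_three_halves_mul_self hc]
  calc ∫ x, cdot ((dil c u : ℝ³ → ℂ³) x) ((dil c w : ℝ³ → ℂ³) x)
      = ∫ x, ((c ^ 3 : ℝ) : ℂ) * F (c • x) := by
        refine integral_congr_ae ?_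
        filter_upwards [coeFn_dil hc.ne' u, coeFn_dil hc.ne' w] with x h1 h2
        rw [h1, h2, cdot_smul_left, cdot_smul_right, ← mul_assoc, hs]
    _ = ((c ^ 3 : ℝ) : ℂ) * ∫ x, F (c • x) := integral_const_mul _ _
    _ = ((c ^ 3 : ℝ) : ℂ) * (|(c ^ 3)⁻¹| • ∫ y, F y) := by
        rw [Measure.integral_comp_smul volume F c, finrank_euclideanSpace, Fintype.card_fin]
    _ = ∫ y, F y := by
        rw [abs_of_pos (inv_pos.2 (pow_pos hc 3)), Complex.real_smul, ← mul_assoc,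
          ← Complex.ofReal_mul, mul_inv_cancel₀ (pow_pos hc 3).ne', Complex.ofReal_one, one_mul]

/-- **Transport of a wavelet pairing**: for `κ, c > 0`,
`⟨Rot_R Dil_κ u, \overline{Dil_c Rot_R Dil_κ g}⟩ = ⟨u, \overline{Dil_c g}⟩` (dilations commute with
each other and with rotations; conjugation commutes with both; the pairing is invariant). [cite: Tao2016AveragedNS, §3.2 p. 15] -/
theorem pairing_rotDil_conjL2_dil (R : ℝ³ ≃ₗᵢ[ℝ] ℝ³) {κ c : ℝ} (hκ : 0 < κ) (hc : 0 < c)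
    (u g : L2C) :
    pairing (rot R (dil κ u)) (conjL2 (dil c (rot R (dil κ g)))) = pairing u (conjL2 (dil c g)) := by
  rw [dil_rot, dil_dil hc hκ, mul_comm c κ, ← dil_dil hκ hc, conjL2_rot,
    conjL2_dil hκ.ne', pairing_rot_rot, pairing_dil_dil hκ]

/-- **The complexified basic cascade form (3.6) under per-slot rotations and dilations**: if
`ψ'ⱼ = Rot_{Rⱼ} Dil_{κⱼ} ψⱼ` in `L²` (`κⱼ > 0`), then for all `u, v, w`
`⟨C_ψ(u,v), w⟩ = ⟨C_{ψ'}(Rot_{R₁} Dil_{κ₁} u, Rot_{R₂} Dil_{κ₂} v), Rot_{R₃} Dil_{κ₃} w⟩` (termwise in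
`n`, so no convergence is needed). [cite: Tao2016AveragedNS, §3.2 p. 15] -/
theorem cplxBasicCascadeForm_transport {ε₀ : ℝ} (hε : 0 < 1 + ε₀) (ψ ψ' : Fin 3 → 𝓢(ℝ³, ℂ³))
    (R : Fin 3 → (ℝ³ ≃ₗᵢ[ℝ] ℝ³)) (κ : Fin 3 → ℝ) (hκ : ∀ i, 0 < κ i)
    (h : ∀ i, (ψ' i).toLp 2 (volume : Measure ℝ³) =
      rot (R i) (dil (κ i) ((ψ i).toLp 2 (volume : Measure ℝ³))))
    (u v w : L2C) :
    cplxBasicCascadeForm ε₀ (ψ 0) (ψ 1) (ψ 2) u v w =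
      cplxBasicCascadeForm ε₀ (ψ' 0) (ψ' 1) (ψ' 2) (rot (R 0) (dil (κ 0) u))
        (rot (R 1) (dil (κ 1) v)) (rot (R 2) (dil (κ 2) w)) := by
  unfold cplxBasicCascadeForm cplxCascadeWavelet
  refine tsum_congr fun n => ?_
  rw [h 0, h 1, h 2, pairing_rotDil_conjL2_dil (R 0) (hκ 0) (zpow_pos hε n),
    pairing_rotDil_conjL2_dil (R 1) (hκ 1) (zpow_pos hε n),
    pairing_rotDil_conjL2_dil (R 2) (hκ 2) (zpow_pos hε n)]

/-! ### Conjugating a complex average by fixed per-slot rotations and dilations -/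

/-- The determinant of a composite of linear isometric automorphisms. [folklore] -/
theorem det_toLinearEquiv_trans (A B : ℝ³ ≃ₗᵢ[ℝ] ℝ³) :
    LinearMap.det ((B.trans A).toLinearEquiv : ℝ³ →ₗ[ℝ] ℝ³) =
      LinearMap.det (A.toLinearEquiv : ℝ³ →ₗ[ℝ] ℝ³) *
        LinearMap.det (B.toLinearEquiv : ℝ³ →ₗ[ℝ] ℝ³) := by
  rw [← LinearMap.det_comp]
  rfl

namespace ComplexAveragingDatum

variable (𝒟 : ComplexAveragingDatum)

/-- **The datum conjugated by fixed per-slot rotations `Rfᵢ ∈ SO(3)` and dilations `κᵢ > 0`**: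
same sample space, measure and multipliers; rotations `R_{i,ω} ∘ Rfᵢ`, dilation factors
`λ_{i,ω} κᵢ` (still in a compact subset of `(0,∞)`). Its slots are the slots of `𝒟` precomposed
with `Rot_{Rfᵢ} Dil_{κᵢ}` (`precomp_slot`). [cite: Tao2016AveragedNS, §3.2 p. 15] -/
def precomp (Rf : Fin 3 → (ℝ³ ≃ₗᵢ[ℝ] ℝ³)) (κ : Fin 3 → ℝ)
    (hRf : ∀ i, LinearMap.det ((Rf i).toLinearEquiv : ℝ³ →ₗ[ℝ] ℝ³) = 1) (hκ : ∀ i, 0 < κ i) :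
    ComplexAveragingDatum where
  Ω := 𝒟.Ω
  μ := 𝒟.μ
  m := 𝒟.m
  R i θ := (Rf i).trans (𝒟.R i θ)
  lam i θ := 𝒟.lam i θ * κ i
  isComplexSymbol := 𝒟.isComplexSymbol
  det_R i θ := by rw [det_toLinearEquiv_trans, 𝒟.det_R i θ, hRf i, one_mul]
  lam_pos i θ := mul_pos (𝒟.lam_pos i θ) (hκ i)
  lam_bdd := by
    obtain ⟨C, hC⟩ := 𝒟.lam_bdd
    set K : ℝ := ∑ j : Fin 3, (κ j + (κ j)⁻¹) with hK
    have hKi : ∀ i, κ i ≤ K ∧ (κ i)⁻¹ ≤ K := fun i => by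
      have h1 : κ i + (κ i)⁻¹ ≤ K :=
        Finset.single_le_sum (f := fun j => κ j + (κ j)⁻¹)
          (fun j _ => add_nonneg (hκ j).le (inv_nonneg.2 (hκ j).le)) (Finset.mem_univ i)
      exact ⟨le_trans (le_add_of_nonneg_right (inv_nonneg.2 (hκ i).le)) h1,
        le_trans (le_add_of_nonneg_left (hκ i).le) h1⟩
    have hKpos : 0 < K := lt_of_lt_of_le (hκ 0) (hKi 0).1
    refine ⟨C * K, fun i θ => ⟨?_, ?_⟩⟩
    · rw [mul_inv]
      exact mul_le_mul (hC i θ).1 ((inv_le_comm₀ hKpos (hκ i)).2 (hKi i).2)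
        (inv_nonneg.2 hKpos.le) (𝒟.lam_pos i θ).le
    · have hCnonneg : 0 ≤ C := le_trans (𝒟.lam_pos i θ).le (hC i θ).2
      exact mul_le_mul (hC i θ).2 (hKi i).1 (hκ i).le hCnonneg
  moment := 𝒟.moment
  measurable_m := 𝒟.measurable_m
  measurable_R i x := 𝒟.measurable_R i (Rf i x)
  measurable_lam i := (𝒟.measurable_lam i).mul_const _

/-- The slots of the conjugated datum: `m(D) Rot_{R Rf} Dil_{λκ} = (m(D) Rot_R Dil_λ) ∘ Rot_{Rf} Dil_κ`. [cite: Tao2016AveragedNS, §3.2 p. 15] -/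
theorem precomp_slot (Rf : Fin 3 → (ℝ³ ≃ₗᵢ[ℝ] ℝ³)) (κ : Fin 3 → ℝ)
    (hRf : ∀ i, LinearMap.det ((Rf i).toLinearEquiv : ℝ³ →ₗ[ℝ] ℝ³) = 1) (hκ : ∀ i, 0 < κ i)
    (i : Fin 3) (θ : 𝒟.Ω) (u : L2C) :
    (𝒟.precomp Rf κ hRf hκ).slot i θ u = 𝒟.slot i θ (rot (Rf i) (dil (κ i) u)) := by
  change fourierMultiplier (𝒟.symbolLp i θ)
      (rot ((Rf i).trans (𝒟.R i θ)) (dil (𝒟.lam i θ * κ i) u)) =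
    fourierMultiplier (𝒟.symbolLp i θ) (rot (𝒟.R i θ) (dil (𝒟.lam i θ) (rot (Rf i) (dil (κ i) u))))
  rw [dil_rot, rot_rot, dil_dil (𝒟.lam_pos i θ) (hκ i)]

/-- The conjugated datum averages `C'` to the average of `C'` at the rotated–dilated arguments. [cite: Tao2016AveragedNS, §3.2 p. 15] -/
theorem precomp_average (Rf : Fin 3 → (ℝ³ ≃ₗᵢ[ℝ] ℝ³)) (κ : Fin 3 → ℝ)
    (hRf : ∀ i, LinearMap.det ((Rf i).toLinearEquiv : ℝ³ →ₗ[ℝ] ℝ³) = 1) (hκ : ∀ i, 0 < κ i)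
    (C' : L2C → L2C → L2C → ℂ) (u v w : L2C) :
    (𝒟.precomp Rf κ hRf hκ).average C' u v w =
      𝒟.average C' (rot (Rf 0) (dil (κ 0) u)) (rot (Rf 1) (dil (κ 1) v))
        (rot (Rf 2) (dil (κ 2) w)) := by
  change ∫ θ, C' ((𝒟.precomp Rf κ hRf hκ).slot 0 θ u) ((𝒟.precomp Rf κ hRf hκ).slot 1 θ v)
      ((𝒟.precomp Rf κ hRf hκ).slot 2 θ w) ∂𝒟.μ = _
  simp only [precomp_slot]
  rfl

end ComplexAveragingDatum

/-- **Conjugating a complex average by fixed per-slot rotations and dilations** ("we have the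
freedom to rotate and dilate each of the `ξⱼ⁰` as we please", Tao §3.2 p. 15): if `C` is a complex
average of `C'`, `Rfᵢ ∈ SO(3)` and `κᵢ > 0`, then
`(u,v,w) ↦ C(Rot_{Rf₁} Dil_{κ₁} u, Rot_{Rf₂} Dil_{κ₂} v, Rot_{Rf₃} Dil_{κ₃} w)` is a complex average of
`C'` (rotations and dilations preserve `H¹⁰_df ⊗ ℂ`). [cite: Tao2016AveragedNS, §3.2 p. 15] -/
theorem IsComplexAverageOf.precomp {C C' : L2C → L2C → L2C → ℂ} (h : IsComplexAverageOf C C')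
    (Rf : Fin 3 → (ℝ³ ≃ₗᵢ[ℝ] ℝ³)) (κ : Fin 3 → ℝ)
    (hRf : ∀ i, LinearMap.det ((Rf i).toLinearEquiv : ℝ³ →ₗ[ℝ] ℝ³) = 1) (hκ : ∀ i, 0 < κ i) :
    IsComplexAverageOf (fun u v w => C (rot (Rf 0) (dil (κ 0) u)) (rot (Rf 1) (dil (κ 1) v))
      (rot (Rf 2) (dil (κ 2) w))) C' := by
  obtain ⟨𝒟, h𝒟⟩ := h
  refine ⟨𝒟.precomp Rf κ hRf hκ, fun u v w hu hv hw => ?_⟩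
  rw [𝒟.precomp_average]
  exact h𝒟 _ _ _ ((hu.dil (hκ 0)).rot _) ((hv.dil (hκ 1)).rot _) ((hw.dil (hκ 2)).rot _)

/-- A form that agrees on `H¹⁰_df ⊗ ℂ` with a complex average of `C'` is a complex average of
`C'` (Definition 3.4 only sees arguments in `H¹⁰_df ⊗ ℂ`). [cite: Tao2016AveragedNS, Def. 3.4] -/
theorem IsComplexAverageOf.of_eqOn {C₁ C₂ C' : L2C → L2C → L2C → ℂ} (h : IsComplexAverageOf C₂ C')
    (heq : ∀ u v w, MemH10dfC u → MemH10dfC v → MemH10dfC w → C₁ u v w = C₂ u v w) :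
    IsComplexAverageOf C₁ C' := by
  obtain ⟨𝒟, h𝒟⟩ := h
  exact ⟨𝒟, fun u v w hu hv hw => (heq u v w hu hv hw).trans (h𝒟 u v w hu hv hw)⟩

end Literature.Analysis.FluidPDE.Tao2016
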